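import Summits.QuantumFields.YangMills.Theorems.LuscherReductionTraceDoorDefs
import Summits.QuantumFields.YangMills.Theorems.FemtoTransferGapBounds
import Summits.QuantumFields.YangMills.Theorems.FemtoTransferGapPositivity
import Summits.QuantumFields.YangMills.Theorems.FemtoTransferGapLevelsDecay
import HarnessLib

/-!
# `TraceDoorGlue` (stmt-QuantumFields-20206) landing — INV ATOMS: relative levels, regularised femto atoms, the dyadic grid (skeleton PART 6 §6.1–§6.2)

Route `LuscherReduction` (owner ym-beyond-p1), RED `RunningReduction` (stmt-QuantumFields-19978) split (route rev 11/12) along the TT door of the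
registered skeleton «KTR» rev 8 (`pub/ym-beyond/p1-g19-files/Lines-KTR-r8.lean`, sha16 4d4e029b06d8e70b); glue item `TraceDoorGlue`
(stmt-QuantumFields-20206) = `TraceFormula → TwistedTraceScaling → OneSiteTail → DressedRitz → RunningReduction`, landed under `Theorems/` as the
file family `LuscherReductionTraceDoor{Defs,Enclosure,Basics,InvAtoms,KT,InvPrep,OST,Glue}.lean` (namespace `…Theorems.FemtoTransferGap.TraceDoor`),
skeleton parts re-homed VERBATIM with the four children taken as the ROUTE DECLS (hypotheses), the skeleton's `Prop` currencies
(`CoarseNoIntruder`, `OneSiteLowerCoarse`, `CoarseLevels`, `OneSiteTraceLimit`) spelled out as texts, the door / Ritz basics / `LevelGapSummable` / ONE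
taken from the tree (`KTDoorR3.katoTempleDoorR3`, `KTDoorR3.ritzBasicsR3`, `LGS.levelGapSummable_all`, `oneSiteLevels_proof`).

THIS FILE (skeleton PART 6 «INV» §6.1 and the lattice-free half of §6.2, VERBATIM over the tree defs `TraceDoor.xval/atomRaw/atomReg/qgrid/qapprox`):
at a fixed lattice, `x_j = λ_j/λ_0 ∈ [0,1]`, the raw atoms `b_j = max(c·log(λ_0/λ_j), δj)` (positive levels) / `j/δ` (zero levels) and their
running maxima `ã_j` (monotone, `ã_0 = 0`, Laplace-summable for every `s > 0`, `summable_exp_atomReg`), the POINTWISE DISCREPANCY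
`|e^{−σã_j} − x_j^T| ≤ min(x_j^T, σδj) + [j ≠ 0]e^{−σj/δ}` (`abs_exp_atomReg_sub_le`), the dyadic femto-time grid and its approximants
(`tendsto_qgrid_qapprox`), the ratio perturbation `|A/B² − A'/B'²| ≤ |A − A'| + 2|B − B'|`, the VIOLATION IN ATOM CURRENCY (`far_of_violation`:
a failure of the coarse two-sided bound at `(L, β)` puts `ã_k` `η/2`-far from `Δ_k`) and the diagonal selection `exists_diag`.

HONEST FRAMING: femto rung R2b1 (`FemtoGapOfRecord`) bookkeeping — the XL content (`TwistedTraceScaling`, `DressedRitz`) is ASSUMED, not proved;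
nothing here bears on infinite volume, the continuum limit or the Clay mass gap.  Sorry-free, no new definitions.
-/

set_option autoImplicit false

noncomputable section

open MeasureTheory Filter Topology Real
open Literature.MathematicalPhysics.QuantumFieldTheory
open Literature.MathematicalPhysics.QuantumLattice
open Literature.Analysis.OperatorTheory.YMMatrixModel
open scoped BigOperators

namespace Summit.QuantumFields.YangMills.Theorems.FemtoTransferGap.TraceDoor

open Summit.QuantumFields.YangMills.Theorems.FemtoTransferGap
open Summit.QuantumFields.YangMills.Theorems.FemtoTransferGap.TT (physTrace)


/-! ## §1 Relative levels and regularised femto atoms at a fixed lattice (skeleton §6.1) -/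

section Fixed

variable {L : ℕ} [NeZero L] {β : ℝ}


/-- `0 ≤ x_j`. -/
theorem xval_nonneg (hβ : 0 < β) (j : ℕ) : 0 ≤ xval L β j :=
  div_nonneg (levelValue_su2Rep_nonneg L hβ.le j) (levelValue_su2Rep_nonneg L hβ.le 0)

/-- `x_j ≤ 1` (`λ_j ≤ λ_0`, tree `levelValue_le_of_le`, `FemtoTransferGapLevelsDecay`). -/
theorem xval_le_one (hβ : 0 < β) (j : ℕ) : xval L β j ≤ 1 := by
  unfold xval
  rw [div_le_one (levelValue_zero_su2Rep_pos L β)]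
  exact levelValue_le_of_le hβ (Nat.zero_le j)

/-- `x_0 = 1`. -/
theorem xval_zero : xval L β 0 = 1 := div_self (levelValue_zero_su2Rep_pos L β).ne'

/-- `x_j^T ≤ x_j²` for `T ≥ 2` (`0 ≤ x_j ≤ 1`). -/
theorem xval_pow_le_sq (hβ : 0 < β) (j : ℕ) {T : ℕ} (hT : 2 ≤ T) : xval L β j ^ T ≤ xval L β j ^ 2 :=
  pow_le_pow_of_le_one (xval_nonneg hβ j) (xval_le_one hβ j) hT

/-- `b_0 = 0`. -/
theorem atomRaw_zero (c δ : ℝ) : atomRaw L β c δ 0 = 0 := by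
  unfold atomRaw
  rw [if_pos (levelValue_zero_su2Rep_pos L β), div_self (levelValue_zero_su2Rep_pos L β).ne', Real.log_one]
  simp

/-- `ã_0 = 0`. -/
theorem atomReg_zero (c δ : ℝ) : atomReg L β c δ 0 = 0 := by
  unfold atomReg; rw [partialSups_zero, atomRaw_zero]

/-- `ã` is monotone (running maximum). -/
theorem atomReg_mono (c δ : ℝ) : Monotone (atomReg L β c δ) := fun _ _ h => (partialSups (atomRaw L β c δ)).monotone h

/-- `δ j ≤ b_j` (`δ ≤ 1`). -/
theorem le_atomRaw (_hβ : 0 < β) {c δ : ℝ} (hδ : 0 < δ) (hδ1 : δ ≤ 1) (j : ℕ) : δ * j ≤ atomRaw L β c δ j := by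
  unfold atomRaw
  split_ifs with h
  · exact le_max_right _ _
  · rw [le_div_iff₀ hδ]
    have hj : (0 : ℝ) ≤ j := Nat.cast_nonneg j
    nlinarith [mul_le_mul_of_nonneg_right hδ1 hj]

/-- `δ j ≤ ã_j`. -/
theorem le_atomReg (hβ : 0 < β) {c δ : ℝ} (hδ : 0 < δ) (hδ1 : δ ≤ 1) (j : ℕ) : δ * j ≤ atomReg L β c δ j :=
  (le_atomRaw hβ hδ hδ1 j).trans (le_partialSups (atomRaw L β c δ) j)

/-- `0 ≤ ã_j`. -/
theorem atomReg_nonneg (hβ : 0 < β) {c δ : ℝ} (hδ : 0 < δ) (hδ1 : δ ≤ 1) (j : ℕ) : 0 ≤ atomReg L β c δ j :=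
  le_trans (by positivity) (le_atomReg hβ hδ hδ1 j)

/-- `Σ_j e^{−s ã_j} < ∞` for every `s > 0` (domination by the geometric series `e^{−sδ j}`). -/
theorem summable_exp_atomReg (hβ : 0 < β) {c δ : ℝ} (hδ : 0 < δ) (hδ1 : δ ≤ 1) {s : ℝ} (hs : 0 < s) :
    Summable fun j : ℕ => Real.exp (-s * atomReg L β c δ j) := by
  have hgeo : Summable fun j : ℕ => Real.exp (-(s * δ)) ^ j :=
    summable_geometric_of_lt_one (Real.exp_pos _).le (Real.exp_lt_one_iff.mpr (by nlinarith [mul_pos hs hδ]))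
  refine Summable.of_nonneg_of_le (fun j => (Real.exp_pos _).le) (fun j => ?_) hgeo
  rw [← Real.exp_nat_mul, Real.exp_le_exp]
  have := le_atomReg (L := L) hβ (c := c) hδ hδ1 j
  nlinarith

/-- On a positive level the running max is attained at the last index: `ã_j = max(c·log(λ_0/λ_j), δ j)`. -/
theorem atomReg_eq_of_pos (hβ : 0 < β) {c δ : ℝ} (hc : 0 ≤ c) (hδ : 0 ≤ δ) {j : ℕ} (hj : 0 < levelValue su2Rep L β j) :
    atomReg L β c δ j = max (c * Real.log (levelValue su2Rep L β 0 / levelValue su2Rep L β j)) (δ * j) := by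
  have key : ∀ i ≤ j, atomRaw L β c δ i ≤ atomRaw L β c δ j := by
    intro i hij
    have hi : 0 < levelValue su2Rep L β i := lt_of_lt_of_le hj (levelValue_le_of_le hβ hij)
    unfold atomRaw
    rw [if_pos hi, if_pos hj]
    apply max_le_max
    · apply mul_le_mul_of_nonneg_left _ hc
      apply Real.log_le_log (div_pos (levelValue_zero_su2Rep_pos L β) hi)
      exact div_le_div_of_nonneg_left (levelValue_zero_su2Rep_pos L β).le hj (levelValue_le_of_le hβ hij)
    · exact mul_le_mul_of_nonneg_left (by exact_mod_cast hij) hδ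
  unfold atomReg
  apply le_antisymm
  · apply partialSups_le
    intro i hi
    have := key i hi
    unfold atomRaw at this ⊢
    rw [if_pos hj] at this
    exact this
  · have := le_partialSups (atomRaw L β c δ) j
    unfold atomRaw at this ⊢
    rw [if_pos hj] at this
    exact this

/-- On a zero level: `ã_j ≥ j/δ`. -/
theorem div_le_atomReg_of_zero {c δ : ℝ} {j : ℕ} (hj : ¬ 0 < levelValue su2Rep L β j) :
    (j : ℝ) / δ ≤ atomReg L β c δ j := by
  have := le_partialSups (atomRaw L β c δ) j
  unfold atomRaw at this
  rw [if_neg hj] at this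
  exact this

/-- The exact identity on positive levels: `e^{−(T/c)·c·log(λ_0/λ_j)} = x_j^T`. -/
theorem exp_neg_mul_log_eq (_hβ : 0 < β) {c : ℝ} (hc : 0 < c) {j : ℕ} (hj : 0 < levelValue su2Rep L β j) (T : ℕ) :
    Real.exp (-((T : ℝ) / c) * (c * Real.log (levelValue su2Rep L β 0 / levelValue su2Rep L β j))) = xval L β j ^ T := by
  have h0 := levelValue_zero_su2Rep_pos L β
  have hx : 0 < xval L β j := div_pos hj h0
  have : -((T : ℝ) / c) * (c * Real.log (levelValue su2Rep L β 0 / levelValue su2Rep L β j)) = (T : ℝ) * Real.log (xval L β j) := by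
    have hlog : Real.log (levelValue su2Rep L β 0 / levelValue su2Rep L β j) = - Real.log (xval L β j) := by
      unfold xval; rw [← Real.log_inv, inv_div]
    rw [hlog]; field_simp
  rw [this, ← Real.log_pow, Real.exp_log (pow_pos hx T)]

/-- **Pointwise discrepancy** between the regularised Laplace weight and the true moment weight at `σ = T/c`:
`|e^{−σ ã_j} − x_j^T| ≤ min(x_j^T, σδ j) + [j ≠ 0]·e^{−σ j/δ}`. -/
theorem abs_exp_atomReg_sub_le (hβ : 0 < β) {c δ : ℝ} (hc : 0 < c) (hδ : 0 < δ) (_hδ1 : δ ≤ 1) (T : ℕ) (j : ℕ) :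
    |Real.exp (-((T : ℝ) / c) * atomReg L β c δ j) - xval L β j ^ T| ≤
      min (xval L β j ^ T) ((T : ℝ) / c * δ * j) + (if j = 0 then 0 else Real.exp (-((T : ℝ) / c) * ((j : ℝ) / δ))) := by
  have hσ : 0 ≤ (T : ℝ) / c := by positivity
  have hxT : 0 ≤ xval L β j ^ T := pow_nonneg (xval_nonneg hβ j) T
  by_cases hj : 0 < levelValue su2Rep L β j
  · -- positive level: weight = min(x^T, e^{−σδj})
    rw [atomReg_eq_of_pos hβ hc.le hδ.le hj]
    have hw : Real.exp (-((T : ℝ) / c) * max (c * Real.log (levelValue su2Rep L β 0 / levelValue su2Rep L β j)) (δ * j)) =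
        min (xval L β j ^ T) (Real.exp (-((T : ℝ) / c) * (δ * j))) := by
      rw [← exp_neg_mul_log_eq hβ hc hj T]
      rcases le_total (c * Real.log (levelValue su2Rep L β 0 / levelValue su2Rep L β j)) (δ * j) with h | h
      · rw [max_eq_right h, min_eq_right]
        exact Real.exp_le_exp.mpr (by nlinarith)
      · rw [max_eq_left h, min_eq_left]
        exact Real.exp_le_exp.mpr (by nlinarith)
    rw [hw]
    have hind : 0 ≤ (if j = 0 then (0 : ℝ) else Real.exp (-((T : ℝ) / c) * ((j : ℝ) / δ))) := by
      split_ifs <;> positivity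
    have h1 : |min (xval L β j ^ T) (Real.exp (-((T : ℝ) / c) * (δ * j))) - xval L β j ^ T| ≤
        min (xval L β j ^ T) ((T : ℝ) / c * δ * j) := by
      rw [abs_sub_comm, abs_of_nonneg (sub_nonneg.mpr (min_le_left _ _))]
      have hmin0 : 0 ≤ min (xval L β j ^ T) (Real.exp (-((T : ℝ) / c) * (δ * j))) := le_min hxT (Real.exp_pos _).le
      apply le_min
      · linarith
      · -- x^T − min(x^T, e^{−y}) ≤ 1 − e^{−y} ≤ y
        have hy : 0 ≤ (T : ℝ) / c * (δ * j) := by positivity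
        have hexp : 1 - (T : ℝ) / c * (δ * j) ≤ Real.exp (-((T : ℝ) / c) * (δ * j)) := by
          have := Real.add_one_le_exp (-((T : ℝ) / c) * (δ * j)); linarith
        have hx1 : xval L β j ^ T ≤ 1 := pow_le_one₀ (xval_nonneg hβ j) (xval_le_one hβ j)
        rcases le_total (xval L β j ^ T) (Real.exp (-((T : ℝ) / c) * (δ * j))) with h | h
        · rw [min_eq_left h]; nlinarith
        · rw [min_eq_right h]; nlinarith
    linarith
  · -- zero level: x_j = 0, weight ≤ e^{−σ j/δ}, and j ≠ 0
    have hj0 : levelValue su2Rep L β j = 0 := le_antisymm (not_lt.mp hj) (levelValue_su2Rep_nonneg L hβ.le j)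
    have hjne : j ≠ 0 := by rintro rfl; exact hj (levelValue_zero_su2Rep_pos L β)
    have hx0 : xval L β j = 0 := by unfold xval; rw [hj0, zero_div]
    have hTpos_or : xval L β j ^ T = 0 ∨ T = 0 := by
      rcases Nat.eq_zero_or_pos T with h | h
      · exact Or.inr h
      · exact Or.inl (by rw [hx0, zero_pow h.ne'])
    rw [if_neg hjne]
    have hle : Real.exp (-((T : ℝ) / c) * atomReg L β c δ j) ≤ Real.exp (-((T : ℝ) / c) * ((j : ℝ) / δ)) := by
      apply Real.exp_le_exp.mpr
      have := div_le_atomReg_of_zero (L := L) (β := β) (c := c) (δ := δ) hj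
      nlinarith
    rcases hTpos_or with h | h
    · rw [h, sub_zero, abs_of_pos (Real.exp_pos _)]
      have : 0 ≤ min (0 : ℝ) ((T : ℝ) / c * δ * j) := le_min le_rfl (by positivity)
      linarith
    · subst h
      simp

end Fixed

/-! ## §2 Grid, ratio perturbation, violation in atom currency, diagonal selection (skeleton §6.2, lattice-free half) -/

/-- Grid points are positive. -/
theorem qgrid_pos (i : ℕ) : 0 < qgrid i := by unfold qgrid; positivity

/-- `q_{qapprox s m} = ⌈s2^m⌉/2^m`. -/
theorem qgrid_qapprox {s : ℝ} (hs : 0 < s) (m : ℕ) : qgrid (qapprox s m) = (⌈s * 2 ^ m⌉₊ : ℝ) / 2 ^ m := by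
  unfold qgrid qapprox
  rw [Nat.unpair_pair]
  simp only
  have h1 : 1 ≤ ⌈s * 2 ^ m⌉₊ := Nat.one_le_iff_ne_zero.mpr (by
    rw [Ne, Nat.ceil_eq_zero, not_le]; positivity)
  congr 1
  rw [Nat.cast_sub h1]; push_cast; ring

/-- The `m`-th approximant lies above `s`. -/
theorem le_qgrid_qapprox {s : ℝ} (hs : 0 < s) (m : ℕ) : s ≤ qgrid (qapprox s m) := by
  rw [qgrid_qapprox hs, le_div_iff₀ (by positivity)]; exact Nat.le_ceil _

/-- `q_{qapprox s m} = ⌈s2^m⌉/2^m`. -/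
theorem qgrid_qapprox_le {s : ℝ} (hs : 0 < s) (m : ℕ) : qgrid (qapprox s m) ≤ s + (1 / 2) ^ m := by
  rw [qgrid_qapprox hs, div_le_iff₀ (by positivity)]
  have h1 : (s + (1 / 2 : ℝ) ^ m) * 2 ^ m = s * 2 ^ m + 1 := by
    rw [add_mul, ← mul_pow]; norm_num
  rw [h1]
  exact (Nat.ceil_lt_add_one (by positivity : 0 ≤ s * 2 ^ m)).le

/-- The approximants converge to `s`. -/
theorem tendsto_qgrid_qapprox {s : ℝ} (hs : 0 < s) : Tendsto (fun m => qgrid (qapprox s m)) atTop (𝓝 s) := by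
  have hlim : Tendsto (fun m : ℕ => s + (1 / 2 : ℝ) ^ m) atTop (𝓝 s) := by
    have := (tendsto_pow_atTop_nhds_zero_of_lt_one (by norm_num : (0 : ℝ) ≤ 1 / 2) (by norm_num : (1 / 2 : ℝ) < 1)).const_add s
    simpa using this
  exact tendsto_of_tendsto_of_tendsto_of_le_of_le tendsto_const_nhds hlim (le_qgrid_qapprox hs) (qgrid_qapprox_le hs)

/-- Elementary ratio perturbation: `|A/B² − A'/B'²| ≤ |A − A'| + 2|B − B'|` for `B, B' ≥ 1`, `0 ≤ A' ≤ B'`. -/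
theorem ratio_sub_ratio_le {A A' B B' : ℝ} (hB : 1 ≤ B) (hB' : 1 ≤ B') (hA' : 0 ≤ A') (hA'B' : A' ≤ B') :
    |A / B ^ 2 - A' / B' ^ 2| ≤ |A - A'| + 2 * |B - B'| := by
  have hB0 : 0 < B := by linarith
  have hB'0 : 0 < B' := by linarith
  have h1 : |A / B ^ 2 - A' / B ^ 2| ≤ |A - A'| := by
    rw [← sub_div, abs_div, abs_of_pos (by positivity : 0 < B ^ 2)]
    exact div_le_self (abs_nonneg _) (one_le_pow₀ hB)
  have h2 : |A' / B ^ 2 - A' / B' ^ 2| ≤ 2 * |B - B'| := by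
    have hid : A' / B ^ 2 - A' / B' ^ 2 = A' * (B' + B) / (B ^ 2 * B' ^ 2) * (B' - B) := by
      field_simp; ring
    rw [hid, abs_mul, abs_of_nonneg (by positivity), abs_sub_comm B B']
    have h3 : B' ^ 2 ≤ B ^ 2 * B' ^ 2 := le_mul_of_one_le_left (by positivity) (one_le_pow₀ hB)
    have h4 : 1 ≤ B * B' := one_le_mul_of_one_le_of_one_le hB hB'
    have h5 : B * B' ≤ B ^ 2 * B' ^ 2 := by nlinarith
    have hcoef : A' * (B' + B) / (B ^ 2 * B' ^ 2) ≤ 2 := by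
      rw [div_le_iff₀ (by positivity)]
      nlinarith [mul_le_mul_of_nonneg_right hA'B' (by positivity : 0 ≤ B' + B)]
    exact mul_le_mul_of_nonneg_right hcoef (abs_nonneg _)
  calc |A / B ^ 2 - A' / B' ^ 2| = |(A / B ^ 2 - A' / B ^ 2) + (A' / B ^ 2 - A' / B' ^ 2)| := by ring_nf
    _ ≤ |A / B ^ 2 - A' / B ^ 2| + |A' / B ^ 2 - A' / B' ^ 2| := abs_add_le _ _
    _ ≤ |A - A'| + 2 * |B - B'| := add_le_add h1 h2

/-- **The violation in atom currency**: if the two-sided coarse bound fails at `(L, β)` and `δ` is small, the regularised atom `ã_k` is `η/2`-far from `Δ_k`. -/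
theorem far_of_violation {L : ℕ} [NeZero L] {β : ℝ} (hβ : 0 < β) (hlam : 0 < luscherLambda β L) {δ η : ℝ}
    (hδ : 0 < δ) (hη : 0 < η) {k : ℕ} (hδk : δ * k ≤ η / 2) (hkδ : k ≠ 0 → levelGap k + η ≤ k / δ)
    (hviol : ¬ (Real.exp (-((levelGap k + η) * luscherLambda β L) / L) * levelValue su2Rep L β 0 ≤ levelValue su2Rep L β k ∧
        levelValue su2Rep L β k ≤ Real.exp (-((levelGap k - η) * luscherLambda β L) / L) * levelValue su2Rep L β 0)) :
    η / 2 ≤ |atomReg L β ((L : ℝ) / luscherLambda β L) δ k - levelGap k| := by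
  have hL : (0 : ℝ) < L := Nat.cast_pos.mpr (Nat.pos_of_ne_zero (NeZero.ne L))
  set c : ℝ := (L : ℝ) / luscherLambda β L with hc_def
  have hc : 0 < c := div_pos hL hlam
  have h0 := levelValue_zero_su2Rep_pos L β
  have hconv : ∀ A : ℝ, -(A * luscherLambda β L) / L = -(A / c) := by
    intro A; rw [hc_def]; field_simp
  by_cases hk : 0 < levelValue su2Rep L β k
  · rw [atomReg_eq_of_pos hβ hc.le hδ.le hk]
    set α : ℝ := c * Real.log (levelValue su2Rep L β 0 / levelValue su2Rep L β k) with hα_def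
    have hα0 : 0 ≤ α :=
      mul_nonneg hc.le (Real.log_nonneg ((one_le_div hk).mpr (levelValue_le_of_le hβ (Nat.zero_le k))))
    have hlk : levelValue su2Rep L β k = Real.exp (-(α / c)) * levelValue su2Rep L β 0 := by
      have : -(α / c) = Real.log (levelValue su2Rep L β k / levelValue su2Rep L β 0) := by
        rw [hα_def, mul_div_cancel_left₀ _ hc.ne', ← Real.log_inv, inv_div]
      rw [this, Real.exp_log (div_pos hk h0), div_mul_cancel₀ _ h0.ne']
    rcases not_and_or.mp hviol with h | h
    · have hlt : levelGap k + η < α := by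
        by_contra hle
        push Not at hle
        apply h
        rw [hconv, hlk]
        apply mul_le_mul_of_nonneg_right _ h0.le
        apply Real.exp_le_exp.mpr
        have := div_le_div_of_nonneg_right hle hc.le
        linarith
      have hmax : levelGap k + η < max α (δ * k) := lt_of_lt_of_le hlt (le_max_left _ _)
      rw [abs_of_pos (by linarith)]
      linarith
    · have hlt : α < levelGap k - η := by
        by_contra hle
        push Not at hle
        apply h
        rw [hconv, hlk]
        apply mul_le_mul_of_nonneg_right _ h0.le
        apply Real.exp_le_exp.mpr
        have := div_le_div_of_nonneg_right hle hc.le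
        linarith
      have hmax : max α (δ * k) ≤ levelGap k - η / 2 := max_le (by linarith) (by linarith)
      rw [abs_of_nonpos (by linarith)]
      linarith
  · have hk0 : k ≠ 0 := by rintro rfl; exact hk h0
    have := div_le_atomReg_of_zero (L := L) (β := β) (c := c) (δ := δ) hk
    have := hkδ hk0
    rw [abs_of_nonneg (by linarith)]
    linarith

/-- **Diagonal selection**: countably many null sequences admit a slowly diverging diagonal. -/
theorem exists_diag {u : ℕ → ℕ → ℝ} (hu : ∀ m, Tendsto (fun n => u n m) atTop (𝓝 0)) :
    ∃ φ : ℕ → ℕ, Tendsto φ atTop atTop ∧ Tendsto (fun n => u n (φ n)) atTop (𝓝 0) := by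
  classical
  have hN : ∀ m : ℕ, ∃ N : ℕ, ∀ n ≥ N, |u n m| ≤ 1 / ((m : ℝ) + 1) := by
    intro m
    obtain ⟨N, hN⟩ := Metric.tendsto_atTop.mp (hu m) (1 / ((m : ℝ) + 1)) (by positivity)
    exact ⟨N, fun n hn => by have := hN n hn; rw [Real.dist_eq, sub_zero] at this; exact this.le⟩
  choose N hN using hN
  refine ⟨fun n => Nat.findGreatest (fun m => N m ≤ n) n, ?_, ?_⟩
  · rw [tendsto_atTop_atTop]
    intro M
    exact ⟨max (N M) M, fun n hn => Nat.le_findGreatest (le_of_max_le_right hn) (le_of_max_le_left hn)⟩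
  · rw [Metric.tendsto_atTop]
    intro ε hε
    obtain ⟨M, hM⟩ := exists_nat_one_div_lt hε
    refine ⟨max (N 0) (max (N M) M), fun n hn => ?_⟩
    have hn0 : N 0 ≤ n := le_of_max_le_left hn
    have hnM : max (N M) M ≤ n := le_of_max_le_right hn
    have hspec : N (Nat.findGreatest (fun m => N m ≤ n) n) ≤ n :=
      Nat.findGreatest_spec (P := fun m => N m ≤ n) (Nat.zero_le n) hn0
    have hge : M ≤ Nat.findGreatest (fun m => N m ≤ n) n :=
      Nat.le_findGreatest (le_of_max_le_right hnM) (le_of_max_le_left hnM)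
    have h1 := hN _ n hspec
    rw [Real.dist_eq, sub_zero]
    have hge' : (M : ℝ) + 1 ≤ (Nat.findGreatest (fun m => N m ≤ n) n : ℝ) + 1 := by exact_mod_cast Nat.succ_le_succ hge
    calc |u n (Nat.findGreatest (fun m => N m ≤ n) n)| ≤ 1 / ((Nat.findGreatest (fun m => N m ≤ n) n : ℝ) + 1) := h1
      _ ≤ 1 / ((M : ℝ) + 1) := one_div_le_one_div_of_le (by positivity) hge'
      _ < ε := hM

end Summit.QuantumFields.YangMills.Theorems.FemtoTransferGap.TraceDoor

end
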